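import Summits.BirchSwinnertonDyer.BirchSwinnertonDyer.Theorems.GenusKolyvaginAtTwoPowDvdShaCardAtTwoRTShaLadder
import Summits.BirchSwinnertonDyer.BirchSwinnertonDyer.Theorems.GenusKolyvaginAtTwoPowDvdShaCardAtTwoRTHeegnerTwinTamagawaValuation
import Literature.NumberTheory.EllipticCurves.KummerMap
import Literature.NumberTheory.EllipticCurves.PeriodIndexCassels
import Literature.NumberTheory.EllipticCurves.MordellWeilRankZeroProofs
import Summits.BirchSwinnertonDyer.BirchSwinnertonDyer.Theorems.GenusKolyvaginAtTwoShaCardDvdPowAtTwoROneBitDescent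
import Summits.BirchSwinnertonDyer.BirchSwinnertonDyer.Theorems.GenusKolyvaginAtTwoEquivariantKolyvaginExactAtTwoEigenClassesFinite
import Literature.NumberTheory.QuadraticFields.ThreeTorsion
import HarnessLib

/-!
# Route `GenusKolyvaginAtTwo`, LINE 18 `plus_descent` on L_T `PowDvdShaCardAtTwoRT` (stmt-BirchSwinnertonDyer-23242), stub 3a⁗
# `stub_twinExhibitionGenus` — TOOLBOX: the RELAXED RUNG on the rank-zero side (a `2^b`-relaxed `2^M`-Selmer class of order `2^a`
# over a field with `2`-divisible Mordell–Weil group forces `2^{2(a−b)} ∣ #Ш[2^∞]`)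

Seat `bsd-line-gk2-p1` g14 (LEAD seat 1/3, cell `bsd-f1-sign2`), `--supports stmt-BirchSwinnertonDyer-23242 --as helper`.
THEOREMS ONLY (no definition, no named fact, no `sorry`).  Nothing here closes an item; BSD is not proved by any of this.

## What this is (the glue between gk2-p3's genus budget and gk2-p2's one-rung ladder, ℚ-side reading of 3a⁗)

The pen's ℚ-side plan for 3a⁗ (card `Cruxes/PowDvdShaCardAtTwoRT/Lines/plus_descent.md` `## v4`–`## v4.4`): an odd-depth Kolyvagin
class descends to `H¹(ℚ, E[2^M])` (inf–res, `E(K)[2] = 0`), lands a priori in the `d_K`-RELAXED Selmer group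
`Sel^rel = res⁻¹(Sel^(2^M)(E_K/K)) ⊓ ⨅_∞` (gk2-p3 `relIndex_selmerGroup_relaxed_le_two_pow_padicValNat_tamagawaProduct_twin`:
`[Sel^rel : Sel^(2^M)(E/ℚ)] ≤ 2^{ord₂ C(Wd)}`), and on the rank-zero side `E(ℚ)` is finite of odd order (Kolyvagin + `ρ̄_{E,2}` onto), so
`Sel^(2^M)(E/ℚ) = Ш(E/ℚ)[2^M]`; then gk2-p2's one rung (`sq_dvd_natCard_primaryComponent_sha_of_dvd_addOrderOf`) squares the order.
This file proves that pipeline as ONE statement, for every number field `K : Type` and every elliptic `E/K`: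

* §1 `torsionH1ToH1_injective_of_divisible` — if `E(K) = n·E(K)` then `H¹(K, E[n]) → H¹(K, E)` is INJECTIVE (Kummer: its kernel is
  `E(K)/nE(K)`; tree `mem_range_kummerMapTorsion_of_torsionH1ToH1_eq_zero`, `kummerMapTorsion_ker`);
  `exists_zsmul_two_pow_eq_of_rank_zero_of_odd_torsionOrder` — `rank E(K) = 0 ∧ #E(K)_tors` odd ⟹ `E(K)` is `2^M`-divisible.
* §2 **`pow_dvd_natCard_primaryComponent_sha_of_nsmul_mem_selmerGroup`** — `E(K)` `2^M`-divisible, `c ∈ H¹(K, E[2^M])` of order `2^a`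
  with `2^b • c ∈ Sel^(2^M)(E/K)`, `Ш(E/K)[2^∞]` finite ⟹ `2^{2(a−b)} ∣ #Ш(E/K)[2^∞]` (valuation form `two_mul_sub_le_padicValNat_…`).
* §3 `pow_dvd_natCard_primaryComponent_sha_of_mem_of_relIndex_le` — the same for `c` in ANY subgroup `R ⊆ H¹(K, E[2^M])` with
  `0 < [R : Sel ⊓ R] ≤ 2^b` (the odd part of the index is harmless: `c ↦ m'•c` keeps the order).
* §4 **`two_mul_sub_padicValNat_tamagawaProduct_le_of_mem_relaxed_heegner`** — the LINE 18 frame over `ℚ`: `W` globally minimal with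
  `C(W)` odd, `K` imaginary quadratic with odd `d_K` and the Heegner hypothesis, `Wd ≅ W^{(d_K)}`, `rank E(ℚ) = 0` with odd `#E(ℚ)_tors`;
  a class `c` of order `2^a` in gk2-p3's relaxed group (finite index assumed, `hm0`) gives
  **`2·(a − ord₂ C(Wd)) ≤ ord₂ #Ш(E/ℚ)[2^∞]`** — i.e. what remains of 3a⁗ on the rank-zero side is the SUPPLY of a descended Kolyvagin
  class of order `2^a`, `a = M₀ − M₁` (+ the avoidance ladder for deeper rungs), and the strictness question at the `a_p`-even prime.

References: [SilvermanAEC2009] VIII.§2, X.4.2; [McCallumLMS1991] §5 p. 310; [Kramer1981] §2 Prop. 3, Thm. 1; [MazurRubin2010] Prop. 3.3.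
-/

noncomputable section

-- `Summit.<P>.<Sub>` repeats `BirchSwinnertonDyer` by the tree's layout convention (D-0017)
set_option linter.dupNamespace false

open scoped Classical

namespace Summit.BirchSwinnertonDyer.BirchSwinnertonDyer.Theorems.GenusExact.PlusDescent

open _root_.WeierstrassCurve AddSubgroup NumberField Literature.NumberTheory.EllipticCurves

/-! ## §1 `Sel ↪ Ш` when the Mordell–Weil group is `n`-divisible -/

section Injective

variable {K : Type} [Field K] [NumberField K] (V : WeierstrassCurve K) [V.IsElliptic]

/-- **`H¹(K, E[n]) → H¹(K, E)` is injective when `E(K) = n·E(K)`** (`n ≠ 0`): a class dying in `H¹(K, E)` is a Kummer class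
`κ(P)` (exactness of the Kummer sequence), and `P = n•Q` lies in `nE(K) = ker κ`. [cite: SilvermanAEC2009, VIII.§2] -/
theorem torsionH1ToH1_injective_of_divisible {n : ℤ} (hn : n ≠ 0)
    (hdivK : ∀ P : V.toAffine.Point, ∃ Q : V.toAffine.Point, n • Q = P) :
    Function.Injective (torsionH1ToH1 V n) := by
  refine (injective_iff_map_eq_zero _).mpr fun y hy ↦ ?_
  obtain ⟨P, hP⟩ := mem_range_kummerMapTorsion_of_torsionH1ToH1_eq_zero V n
    (V.zsmul_geomPoints_surjective_holds hn) y hy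
  obtain ⟨Q, hQ⟩ := hdivK P
  have hker : P ∈ (kummerMapTorsion V n (V.zsmul_geomPoints_surjective_holds hn)).ker := by
    rw [kummerMapTorsion_ker]
    exact ⟨Q, by simpa using hQ⟩
  rw [← hP]
  exact (AddMonoidHom.mem_ker).mp hker

omit [NumberField K] [V.IsElliptic] in
/-- An element of odd order is `2^M`-divisible inside the cyclic group it generates: `P = 2^M • (m • P)`. [folklore] -/
theorem exists_zsmul_two_pow_eq_of_odd_addOrderOf (M : ℕ) {P : V.toAffine.Point} (hP : Odd (addOrderOf P)) :
    ∃ Q : V.toAffine.Point, ((2 ^ M : ℕ) : ℤ) • Q = P := by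
  have hcop : (2 ^ M).Coprime (addOrderOf P) := (Nat.coprime_two_left.mpr hP).pow_left M
  obtain ⟨m, hm⟩ := exists_nsmul_eq_self_of_coprime hcop
  refine ⟨m • P, ?_⟩
  rw [natCast_zsmul, ← mul_nsmul', mul_comm, mul_nsmul', hm]

/-- **A Mordell–Weil group of rank `0` and odd order is `2^M`-divisible** (the tree's currency: `W.mordellWeilRank = 0`,
`Odd W.torsionOrder`; on the LINE 18 frame over `ℚ`: rank `0` by Kolyvagin, odd torsion from `ρ̄_{E,2}` onto via
`odd_torsionOrder_of_forall_two_nsmul`).  Every `P ∈ E(K) = E(K)_tors` has order dividing `#E(K)_tors`, hence odd.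
[cite: SilvermanAEC2009, VIII.6.7] -/
theorem exists_zsmul_two_pow_eq_of_rank_zero_of_odd_torsionOrder (hrk : V.mordellWeilRank = 0)
    (htor : Odd V.torsionOrder) (M : ℕ) (P : V.toAffine.Point) :
    ∃ Q : V.toAffine.Point, ((2 ^ M : ℕ) : ℤ) • Q = P := by
  haveI : Finite V.toAffine.Point := V.finite_point_of_rank_zero hrk
  have hfin : IsOfFinAddOrder P := isOfFinAddOrder_of_finite P
  have hmem : P ∈ AddCommGroup.torsion V.toAffine.Point := (AddCommGroup.mem_torsion P).mpr hfin
  have hdvd : addOrderOf P ∣ V.torsionOrder := by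
    unfold WeierstrassCurve.torsionOrder
    rw [← addOrderOf_mk P hmem]
    exact addOrderOf_dvd_natCard _
  exact exists_zsmul_two_pow_eq_of_odd_addOrderOf V M (htor.of_dvd_nat hdvd)

end Injective

/-! ## §2 The rung: a `2^b`-relaxed Selmer class of order `2^a` forces `2^{2(a−b)} ∣ #Ш[2^∞]` -/

section Rung

variable {K : Type} [Field K] [NumberField K] (V : WeierstrassCurve K) [V.IsElliptic]

/-- **THE RELAXED RUNG.**  `E/K` elliptic over a number field with `E(K)` `2^M`-divisible, `Ш(E/K)[2^∞]` finite; `c ∈ H¹(K, E[2^M])` of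
order `2^a` with `2^b • c ∈ Sel^(2^M)(E/K)`.  Then `2^{2(a−b)} ∣ #Ш(E/K)[2^∞]`: `y = 2^b•c ∈ Sel` has order `2^{a−b}`, maps INJECTIVELY into
`Ш(E/K)` (§1), lands in `Ш[2^∞]`, and gk2-p2's one rung (`sq_dvd_natCard_primaryComponent_sha_of_dvd_addOrderOf`, Cassels–Tate hyperbolic
plane) squares it. [cite: McCallumLMS1991, §5 p. 310] [cite: SilvermanAEC2009, X.4.2] -/
theorem pow_dvd_natCard_primaryComponent_sha_of_nsmul_mem_selmerGroup
    [Finite (AddCommGroup.primaryComponent V.sha 2)] (M : ℕ)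
    (hdivK : ∀ P : V.toAffine.Point, ∃ Q : V.toAffine.Point, ((2 ^ M : ℕ) : ℤ) • Q = P)
    {c : galH1Torsion V ((2 ^ M : ℕ) : ℤ)} {a b : ℕ} (hca : addOrderOf c = 2 ^ a)
    (hbc : (2 ^ b) • c ∈ selmerGroup V ((2 ^ M : ℕ) : ℤ)) :
    2 ^ (2 * (a - b)) ∣ Nat.card (AddCommGroup.primaryComponent V.sha 2) := by
  haveI : Fact (Nat.Prime 2) := ⟨Nat.prime_two⟩
  rcases Nat.lt_or_ge b a with hab | hab
  swap
  · rw [Nat.sub_eq_zero_of_le hab, mul_zero, pow_zero]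
    exact one_dvd _
  have hn : ((2 ^ M : ℕ) : ℤ) ≠ 0 := by exact_mod_cast pow_ne_zero M two_ne_zero
  set y : galH1Torsion V ((2 ^ M : ℕ) : ℤ) := (2 ^ b) • c with hy
  have hy_ord : addOrderOf y = 2 ^ (a - b) := by
    rw [hy, addOrderOf_nsmul_of_dvd (pow_ne_zero b two_ne_zero) (hca ▸ pow_dvd_pow 2 hab.le), hca,
      Nat.pow_div hab.le two_pos]
  set z : V.galH1 := torsionH1ToH1 V ((2 ^ M : ℕ) : ℤ) y with hz
  have hz_sha : z ∈ V.sha := torsionH1ToH1_mem_sha_of_mem_selmerGroup V hn hbc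
  have hz_ord : addOrderOf z = 2 ^ (a - b) := by
    rw [hz, addOrderOf_injective (torsionH1ToH1 V ((2 ^ M : ℕ) : ℤ))
      (torsionH1ToH1_injective_of_divisible V hn hdivK) y, hy_ord]
  have hz_ord' : addOrderOf (⟨z, hz_sha⟩ : V.sha) = 2 ^ (a - b) := by
    rw [← hz_ord]; exact addOrderOf_mk z hz_sha
  have hmem : (⟨z, hz_sha⟩ : V.sha) ∈ AddCommGroup.primaryComponent V.sha 2 :=
    (AddCommGroup.mem_primaryComponent_iff_addOrderOf (G := V.sha) (p := 2)).mpr ⟨a - b, hz_ord'⟩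
  have hz2 : 2 ^ (a - b) ∣ addOrderOf (⟨⟨z, hz_sha⟩, hmem⟩ : AddCommGroup.primaryComponent V.sha 2) := by
    rw [addOrderOf_mk, hz_ord']
  exact sq_dvd_natCard_primaryComponent_sha_of_dvd_addOrderOf V 2 hz2

/-- **The relaxed rung, valuation form** (the currency of 3a⁗): under the hypotheses of
`pow_dvd_natCard_primaryComponent_sha_of_nsmul_mem_selmerGroup`, `2(a − b) ≤ ord₂ #Ш(E/K)[2^∞]`. [cite: McCallumLMS1991, §5 p. 310] -/
theorem two_mul_sub_le_padicValNat_natCard_primaryComponent_sha_of_nsmul_mem_selmerGroup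
    [Finite (AddCommGroup.primaryComponent V.sha 2)] (M : ℕ)
    (hdivK : ∀ P : V.toAffine.Point, ∃ Q : V.toAffine.Point, ((2 ^ M : ℕ) : ℤ) • Q = P)
    {c : galH1Torsion V ((2 ^ M : ℕ) : ℤ)} {a b : ℕ} (hca : addOrderOf c = 2 ^ a)
    (hbc : (2 ^ b) • c ∈ selmerGroup V ((2 ^ M : ℕ) : ℤ)) :
    2 * (a - b) ≤ padicValNat 2 (Nat.card (AddCommGroup.primaryComponent V.sha 2)) := by
  haveI : Fact (Nat.Prime 2) := ⟨Nat.prime_two⟩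
  rw [← padicValNat_dvd_iff_le (Nat.card_pos (α := AddCommGroup.primaryComponent V.sha 2)).ne']
  exact pow_dvd_natCard_primaryComponent_sha_of_nsmul_mem_selmerGroup V M hdivK hca hbc

/-! ## §3 The same for a class in any subgroup of finite `2`-bounded index over the Selmer group -/

/-- **The relaxed rung, index form.**  `E(K)` `2^M`-divisible, `Ш(E/K)[2^∞]` finite, `R ⊆ H¹(K, E[2^M])` any subgroup with
`0 < (Sel ⊓ R).relIndex R ≤ 2^b`, `c ∈ R` of order `2^a` ⟹ `2^{2(a−b)} ∣ #Ш(E/K)[2^∞]`.  (Write the index `m = 2^j·m'` with `m'` odd: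
`m'•c` has the same order, `2^j•(m'•c) = m•c ∈ Sel`, and `2^j ≤ m ≤ 2^b`.) [cite: McCallumLMS1991, §5 p. 310] [cite: Kramer1981, Thm. 1] -/
theorem pow_dvd_natCard_primaryComponent_sha_of_mem_of_relIndex_le
    [Finite (AddCommGroup.primaryComponent V.sha 2)] (M : ℕ)
    (hdivK : ∀ P : V.toAffine.Point, ∃ Q : V.toAffine.Point, ((2 ^ M : ℕ) : ℤ) • Q = P)
    (R : AddSubgroup (galH1Torsion V ((2 ^ M : ℕ) : ℤ))) {b : ℕ}
    (hm0 : (selmerGroup V ((2 ^ M : ℕ) : ℤ)).relIndex R ≠ 0) (hmb : (selmerGroup V ((2 ^ M : ℕ) : ℤ)).relIndex R ≤ 2 ^ b)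
    {c : galH1Torsion V ((2 ^ M : ℕ) : ℤ)} (hc : c ∈ R) {a : ℕ} (hca : addOrderOf c = 2 ^ a) :
    2 ^ (2 * (a - b)) ∣ Nat.card (AddCommGroup.primaryComponent V.sha 2) := by
  set m := (selmerGroup V ((2 ^ M : ℕ) : ℤ)).relIndex R with hm
  have hmc : m • c ∈ selmerGroup V ((2 ^ M : ℕ) : ℤ) := AddSubgroup.nsmul_relIndex_mem _ hc
  obtain ⟨j, m', hm'odd, hmeq⟩ := Nat.exists_eq_two_pow_mul_odd hm0
  -- `c' = m' • c` has the same order `2^a`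
  have hcop : (addOrderOf c).Coprime m' := by
    rw [hca]
    exact (Nat.coprime_two_left.mpr hm'odd).pow_left a
  have hc'a : addOrderOf (m' • c) = 2 ^ a := by rw [hcop.addOrderOf_nsmul, hca]
  -- `2^j ≤ m ≤ 2^b`
  have hj : j ≤ b := by
    have h1 : 2 ^ j ≤ m := by
      rw [hmeq]
      exact Nat.le_mul_of_pos_right _ hm'odd.pos
    exact (Nat.pow_le_pow_iff_right Nat.one_lt_two).mp (h1.trans hmb)
  have hbc' : (2 ^ b) • (m' • c) ∈ selmerGroup V ((2 ^ M : ℕ) : ℤ) := by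
    have h2j : (2 ^ j) • (m' • c) = m • c := by rw [← mul_nsmul', hmeq]
    have : (2 ^ b) • (m' • c) = (2 ^ (b - j)) • ((2 ^ j) • (m' • c)) := by
      rw [← mul_nsmul' (m' • c) (2 ^ (b - j)) (2 ^ j), ← pow_add, Nat.sub_add_cancel hj]
    rw [this, h2j]
    exact AddSubgroup.nsmul_mem _ hmc _
  exact pow_dvd_natCard_primaryComponent_sha_of_nsmul_mem_selmerGroup V M hdivK hc'a hbc'

end Rung

/-! ## §4 The LINE 18 frame over `ℚ`: the genus budget `2^{ord₂ C(Wd)}` as the relaxation -/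

section Frame

variable (W : WeierstrassCurve ℚ) [W.IsElliptic] [W.IsGloballyMinimal]
  {K : Type} [Field K] [NumberField K]

/-- **RANK-ZERO SIDE OF 3a⁗, REDUCED TO SUPPLY.**  `W/ℚ` globally minimal elliptic with `C(W)` odd, `K` imaginary quadratic with odd `d_K`
and the Heegner hypothesis for `N_W`, `Wd = Cd • W^{(d_K)}` any model of the twin, `rank E(ℚ) = 0` and `#E(ℚ)_tors` odd (on the LINE 18
frame: Kolyvagin + `ρ̄_{E,2}` onto, `odd_torsionOrder_of_forall_two_nsmul`), `Ш(E/ℚ)[2^∞]` finite, and the `d_K`-relaxed `2^M`-Selmer group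
`R = res⁻¹(Sel^(2^M)(E_K/K)) ⊓ ⨅_∞` of finite index over `Sel^(2^M)(E/ℚ)` (`hm0`).  Then every `c ∈ R` of order `2^a` gives
**`2·(a − ord₂ C(Wd)) ≤ ord₂ #Ш(E/ℚ)[2^∞]`** — §3 with gk2-p3's budget `[R : Sel] ≤ 2^{ord₂ C(Wd)}`
(`relIndex_selmerGroup_relaxed_le_two_pow_padicValNat_tamagawaProduct_twin`).  Feeding `a = M₀ − M₁` (the descended depth-one
Kolyvagin class) is the SUPPLY the 3a⁗ reader owes; deeper rungs go through gk2-p2's avoidance ladder instead of the one rung.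
[cite: McCallumLMS1991, §5 Prop. 5.2 and p. 310] [cite: Kramer1981, §2 Prop. 3 and Thm. 1] [cite: MazurRubin2010, Prop. 3.3] -/
theorem two_mul_sub_padicValNat_tamagawaProduct_le_of_mem_relaxed_heegner (hK : IsImaginaryQuadratic K)
    (hodd : Odd (NumberField.discr K)) (hH : SatisfiesHeegnerHypothesis (W.conductorNorm ℤ) K)
    (hT : Odd W.tamagawaProduct) {Wd : WeierstrassCurve ℚ} [Wd.IsElliptic] (Cd : VariableChange ℚ)
    (hWd : Cd • W.quadraticTwist (NumberField.discr K : ℚ) = Wd)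
    (hrk : W.mordellWeilRank = 0) (htor : Odd W.torsionOrder)
    [Finite (AddCommGroup.primaryComponent W.sha 2)] (M : ℕ)
    (hm0 : (selmerGroup W ((2 ^ M : ℕ) : ℤ)).relIndex
      ((selmerGroup (W.baseChange K) ((2 ^ M : ℕ) : ℤ)).comap (resTorsion W K ((2 ^ M : ℕ) : ℤ)) ⊓
        ⨅ w : InfinitePlace ℚ, selmerLocalKer W w.Completion ((2 ^ M : ℕ) : ℤ)) ≠ 0)
    {c : galH1Torsion W ((2 ^ M : ℕ) : ℤ)}
    (hc : c ∈ (selmerGroup (W.baseChange K) ((2 ^ M : ℕ) : ℤ)).comap (resTorsion W K ((2 ^ M : ℕ) : ℤ)) ⊓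
        ⨅ w : InfinitePlace ℚ, selmerLocalKer W w.Completion ((2 ^ M : ℕ) : ℤ))
    {a : ℕ} (hca : addOrderOf c = 2 ^ a) :
    2 * (a - padicValNat 2 Wd.tamagawaProduct) ≤ padicValNat 2 (Nat.card (AddCommGroup.primaryComponent W.sha 2)) := by
  haveI : Fact (Nat.Prime 2) := ⟨Nat.prime_two⟩
  rw [← padicValNat_dvd_iff_le (Nat.card_pos (α := AddCommGroup.primaryComponent W.sha 2)).ne']
  exact pow_dvd_natCard_primaryComponent_sha_of_mem_of_relIndex_le W M
    (exists_zsmul_two_pow_eq_of_rank_zero_of_odd_torsionOrder W hrk htor M) _ hm0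
    (relIndex_selmerGroup_relaxed_le_two_pow_padicValNat_tamagawaProduct_twin W hK hodd hH hT Cd hWd _) hc hca

end Frame

/-! ## §5 On `Δ < 0` a single class loses at most ONE bit (gk2-p3's one-bit descent): no index, no budget

Appended by `bsd-line-gk2-p1` g14 (same seat, same session).  gk2-p3 g14's `GenusExact.SelmerDescent.two_zsmul_mem_selmerGroup_of_resTorsion_mem`
(`…ShaCardDvdPowAtTwoROneBitDescent`): on `Δ(E) < 0`, `res u ∈ Sel^{(n)}(E_K/K) ⟹ 2u ∈ Sel^{(n)}(E/ℚ)` for EVERY `u ∈ H¹(ℚ, E[n])`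
(cor ∘ res = 2 kills each local obstruction `H¹(K_w/ℚ_v, E(K_w))`; the real places carry no condition on `Δ < 0`).  So for the ORDER of
one descended class the genus budget `2^{ord₂ C(Wd)}` of §4 (which counts MANY classes) is replaced by the flat factor `2`:
-/

section OneBit

variable (W : WeierstrassCurve ℚ) [W.IsElliptic] {K : Type} [Field K] [NumberField K]

/-- **THE ONE-BIT RUNG on `Δ < 0` (rank-zero side of 3a⁗ at one depth, reduced to SUPPLY, budget-free).**  `W/ℚ` elliptic with
`Δ < 0`, `rank E(ℚ) = 0` and `#E(ℚ)_tors` odd, `[K : ℚ] = 2`, `Ш(E/ℚ)[2^∞]` finite; `c ∈ H¹(ℚ, E[2^M])` of order `2^a` whose restriction to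
`K` is Selmer (`res c ∈ Sel^(2^M)(E_K/K)` — e.g. the descent of an odd-depth Kolyvagin class `c_M(n)`, `τ c = c`, once it is Selmer over `K`).
Then **`2(a − 1) ≤ ord₂ #Ш(E/ℚ)[2^∞]`**: `2c ∈ Sel^(2^M)(E/ℚ)` (one-bit descent), `Sel ↪ Ш` (§1), one rung (gk2-p2).  PRIME-LEVEL READING
of LINE 18 (pen v4.4, `hPn` with `n = ℓ` prime, so `M₁ = 0` and the depth-one class has order `2^{M₀}`): this gives `2M₀ − 2 ≤ ord₂ g`, and
3a⁗'s `2M₀ ≤ ord₂ g + ord₂ g′ + ord₂ C(Wd)` follows whenever `ord₂ g′ + ord₂ C(Wd) ≥ 2`, i.e. (Cassels–Tate evenness of `ord₂ g′`,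
`GenusExact.CasselsTateNumberField.isSquare_natCard_primaryComponent_sha`; oddness of `ord₂ C(Wd)`, `stub_genusParity`) UNLESS
`ord₂ C(Wd) = 1 ∧ Ш(E^{(d_K)}/ℚ)[2] = 0` — the one residual case, where the descended class must be shown STRICT at the unique
transposition prime (the pen's v4.4 warning, now quantified: exactly one bit, exactly one case).
[cite: McCallumLMS1991, §4 Lemma 4.3 and §5 p. 310] [cite: Kolyvagin1989Izv, §3] [cite: Kramer1981, §2 Prop. 3] -/
theorem two_mul_sub_one_le_padicValNat_sha_of_resTorsion_mem_selmerGroup (h2 : Module.finrank ℚ K = 2) (hΔ : W.Δ < 0)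
    (hrk : W.mordellWeilRank = 0) (htor : Odd W.torsionOrder) [Finite (AddCommGroup.primaryComponent W.sha 2)] (M : ℕ)
    {c : galH1Torsion W ((2 ^ M : ℕ) : ℤ)}
    (hc : resTorsion W K ((2 ^ M : ℕ) : ℤ) c ∈ selmerGroup (W.baseChange K) ((2 ^ M : ℕ) : ℤ))
    {a : ℕ} (hca : addOrderOf c = 2 ^ a) :
    2 * (a - 1) ≤ padicValNat 2 (Nat.card (AddCommGroup.primaryComponent W.sha 2)) := by
  have h2c : (2 ^ 1) • c ∈ selmerGroup W ((2 ^ M : ℕ) : ℤ) := by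
    rw [pow_one, two_nsmul, ← two_zsmul]
    exact GenusExact.SelmerDescent.two_zsmul_mem_selmerGroup_of_resTorsion_mem W h2 hΔ _ hc
  exact two_mul_sub_le_padicValNat_natCard_primaryComponent_sha_of_nsmul_mem_selmerGroup W M
    (exists_zsmul_two_pow_eq_of_rank_zero_of_odd_torsionOrder W hrk htor M) hca h2c

/-- **The same in divisibility form**: `2^{2(a−1)} ∣ #Ш(E/ℚ)[2^∞]`. [cite: McCallumLMS1991, §5 p. 310] -/
theorem pow_dvd_natCard_sha_of_resTorsion_mem_selmerGroup (h2 : Module.finrank ℚ K = 2) (hΔ : W.Δ < 0)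
    (hrk : W.mordellWeilRank = 0) (htor : Odd W.torsionOrder) [Finite (AddCommGroup.primaryComponent W.sha 2)] (M : ℕ)
    {c : galH1Torsion W ((2 ^ M : ℕ) : ℤ)}
    (hc : resTorsion W K ((2 ^ M : ℕ) : ℤ) c ∈ selmerGroup (W.baseChange K) ((2 ^ M : ℕ) : ℤ))
    {a : ℕ} (hca : addOrderOf c = 2 ^ a) :
    2 ^ (2 * (a - 1)) ∣ Nat.card (AddCommGroup.primaryComponent W.sha 2) := by
  have h2c : (2 ^ 1) • c ∈ selmerGroup W ((2 ^ M : ℕ) : ℤ) := by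
    rw [pow_one, two_nsmul, ← two_zsmul]
    exact GenusExact.SelmerDescent.two_zsmul_mem_selmerGroup_of_resTorsion_mem W h2 hΔ _ hc
  exact pow_dvd_natCard_primaryComponent_sha_of_nsmul_mem_selmerGroup W M
    (exists_zsmul_two_pow_eq_of_rank_zero_of_odd_torsionOrder W hrk htor M) hca h2c

end OneBit

/-! ## §6 The relaxed group has FINITE index on the frame (`ρ̄_{E,2}` onto): `hm0` of §4 discharged; binder-light forms of §4/§5

Appended by `bsd-line-gk2-p1` g14.  `ρ̄_{E,2}` onto ⟹ `E(K)[2] = 0` for every imaginary quadratic `K`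
(`forall_two_nsmul_baseChange_of_hasSurjectiveModNGaloisRep_two_of_isImaginaryQuadratic`: an irreducible cubic has no root in a
quadratic field) ⟹ `res : H¹(ℚ, E[2^M]) → H¹(K, E_K[2^M])` is INJECTIVE (gk2-p3 `EigenClassesFinite.resTorsion_injective_of_noTorsion`)
⟹ `res⁻¹(Sel^{(2^M)}(E_K/K))` is finite (`finite_selmerGroup_holds`) ⟹ `[R : Sel] ≠ 0`; and `#E(ℚ)_tors` is odd
(`odd_torsionOrder_of_hasSurjectiveModNGaloisRep_two`).
-/

section FiniteIndex

variable (W : WeierstrassCurve ℚ) [W.IsElliptic] {K : Type} [Field K] [NumberField K]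

omit [W.IsElliptic] in
/-- No `2`-torsion ⟹ no `2^M`-torsion. [folklore] -/
theorem forall_two_pow_zsmul_eq_zero_imp (h2 : ∀ P : (W.baseChange K).toAffine.Point, 2 • P = 0 → P = 0) (M : ℕ) :
    ∀ P : (W.baseChange K).toAffine.Point, ((2 ^ M : ℕ) : ℤ) • P = 0 → P = 0 := by
  induction M with
  | zero =>
    intro P hP
    simpa using hP
  | succ M ih =>
    intro P hP
    refine ih P ?_
    apply h2
    rw [natCast_zsmul] at hP ⊢
    rw [smul_smul, ← pow_succ']
    exact hP

/-- **`[res⁻¹(Sel^{(2^M)}(E_K/K)) ⊓ ⨅_∞ : Sel^{(2^M)}(E/ℚ)]` is finite (non-zero `relIndex`)** for `W/ℚ` elliptic with `ρ̄_{E,2}` onto and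
`K` imaginary quadratic: the relaxed group is finite, being cut out of the preimage of the finite `Sel^{(2^M)}(E_K/K)` under the
injective restriction. [cite: SilvermanAEC2009, X.4.2(b)] [cite: SerreGaloisCohomology1997, I §2.6 (b)] -/
theorem relIndex_selmerGroup_relaxed_ne_zero (hK : IsImaginaryQuadratic K) (hρ : W.HasSurjectiveModNGaloisRep 2) (M : ℕ) :
    (selmerGroup W ((2 ^ M : ℕ) : ℤ)).relIndex
      ((selmerGroup (W.baseChange K) ((2 ^ M : ℕ) : ℤ)).comap (resTorsion W K ((2 ^ M : ℕ) : ℤ)) ⊓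
        ⨅ w : InfinitePlace ℚ, selmerLocalKer W w.Completion ((2 ^ M : ℕ) : ℤ)) ≠ 0 := by
  haveI hEK : (W.baseChange K).IsElliptic := by rw [WeierstrassCurve.baseChange]; infer_instance
  have hn : ((2 ^ M : ℕ) : ℤ) ≠ 0 := by exact_mod_cast pow_ne_zero M two_ne_zero
  obtain ⟨θ, hθ, hθsq⟩ := Literature.NumberTheory.QuadraticFields.Quadratic.exists_not_mem_range_sq_eq_discr (K := K) hK.1
  have hL : ∀ P : (W.baseChange K).toAffine.Point, ((2 ^ M : ℕ) : ℤ) • P = 0 → P = 0 :=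
    forall_two_pow_zsmul_eq_zero_imp W
      (forall_two_nsmul_baseChange_of_hasSurjectiveModNGaloisRep_two_of_isImaginaryQuadratic W hρ K hK) M
  have hinj : Function.Injective (resTorsion W K ((2 ^ M : ℕ) : ℤ)) :=
    GenusExact.EigenClassesFinite.resTorsion_injective_of_noTorsion W K hK.1 hθ hθsq _ hL
  haveI : Finite (selmerGroup (W.baseChange K) ((2 ^ M : ℕ) : ℤ)) := (W.baseChange K).finite_selmerGroup_holds hn
  set R : AddSubgroup (galH1Torsion W ((2 ^ M : ℕ) : ℤ)) :=
    (selmerGroup (W.baseChange K) ((2 ^ M : ℕ) : ℤ)).comap (resTorsion W K ((2 ^ M : ℕ) : ℤ)) ⊓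
      ⨅ w : InfinitePlace ℚ, selmerLocalKer W w.Completion ((2 ^ M : ℕ) : ℤ) with hR
  haveI : Finite R := by
    refine Finite.of_injective (fun x : R ↦ (⟨resTorsion W K ((2 ^ M : ℕ) : ℤ) x.1,
      AddSubgroup.mem_comap.mp (AddSubgroup.mem_inf.mp x.2).1⟩ : selmerGroup (W.baseChange K) ((2 ^ M : ℕ) : ℤ))) ?_
    intro x y hxy
    exact Subtype.ext (hinj (congrArg Subtype.val hxy))
  change ((selmerGroup W ((2 ^ M : ℕ) : ℤ)).addSubgroupOf R).index ≠ 0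
  exact AddSubgroup.index_ne_zero_of_finite

/-- **§4 without `hm0` and without the torsion binders**: on the LINE 18 frame (`W` globally minimal with `C(W)` odd and `ρ̄_{E,2}` onto,
`rank E(ℚ) = 0`, `K` imaginary quadratic with odd `d_K` and Heegner, `Wd ≅ W^{(d_K)}`), every class `c` of order `2^a` in the
`d_K`-relaxed `2^M`-Selmer group gives `2·(a − ord₂ C(Wd)) ≤ ord₂ #Ш(E/ℚ)[2^∞]`. [cite: McCallumLMS1991, §5 p. 310] [cite: Kramer1981, Thm. 1] -/
theorem two_mul_sub_padicValNat_tamagawaProduct_le_of_mem_relaxed_heegner' [W.IsGloballyMinimal] (hK : IsImaginaryQuadratic K)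
    (hodd : Odd (NumberField.discr K)) (hH : SatisfiesHeegnerHypothesis (W.conductorNorm ℤ) K)
    (hT : Odd W.tamagawaProduct) (hρ : W.HasSurjectiveModNGaloisRep 2) (hrk : W.mordellWeilRank = 0)
    {Wd : WeierstrassCurve ℚ} [Wd.IsElliptic] (Cd : VariableChange ℚ) (hWd : Cd • W.quadraticTwist (NumberField.discr K : ℚ) = Wd)
    [Finite (AddCommGroup.primaryComponent W.sha 2)] (M : ℕ) {c : galH1Torsion W ((2 ^ M : ℕ) : ℤ)}
    (hc : c ∈ (selmerGroup (W.baseChange K) ((2 ^ M : ℕ) : ℤ)).comap (resTorsion W K ((2 ^ M : ℕ) : ℤ)) ⊓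
        ⨅ w : InfinitePlace ℚ, selmerLocalKer W w.Completion ((2 ^ M : ℕ) : ℤ))
    {a : ℕ} (hca : addOrderOf c = 2 ^ a) :
    2 * (a - padicValNat 2 Wd.tamagawaProduct) ≤ padicValNat 2 (Nat.card (AddCommGroup.primaryComponent W.sha 2)) :=
  two_mul_sub_padicValNat_tamagawaProduct_le_of_mem_relaxed_heegner W hK hodd hH hT Cd hWd hrk
    (odd_torsionOrder_of_hasSurjectiveModNGaloisRep_two W hρ) M (relIndex_selmerGroup_relaxed_ne_zero W hK hρ M) hc hca

/-- **§5 on the frame binders**: `Δ<0`, `ρ̄_{E,2}` onto, `rank E(ℚ) = 0`, `K` imaginary quadratic, `res c ∈ Sel^{(2^M)}(E_K/K)`, `ord c = 2^a`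
⟹ `2(a−1) ≤ ord₂ #Ш(E/ℚ)[2^∞]`. [cite: McCallumLMS1991, §4 Lemma 4.3 and §5 p. 310] -/
theorem two_mul_sub_one_le_padicValNat_sha_of_resTorsion_mem_selmerGroup' (hK : IsImaginaryQuadratic K) (hΔ : W.Δ < 0)
    (hρ : W.HasSurjectiveModNGaloisRep 2) (hrk : W.mordellWeilRank = 0) [Finite (AddCommGroup.primaryComponent W.sha 2)] (M : ℕ)
    {c : galH1Torsion W ((2 ^ M : ℕ) : ℤ)}
    (hc : resTorsion W K ((2 ^ M : ℕ) : ℤ) c ∈ selmerGroup (W.baseChange K) ((2 ^ M : ℕ) : ℤ))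
    {a : ℕ} (hca : addOrderOf c = 2 ^ a) :
    2 * (a - 1) ≤ padicValNat 2 (Nat.card (AddCommGroup.primaryComponent W.sha 2)) :=
  two_mul_sub_one_le_padicValNat_sha_of_resTorsion_mem_selmerGroup W hK.1 hΔ hrk
    (odd_torsionOrder_of_hasSurjectiveModNGaloisRep_two W hρ) M hc hca

end FiniteIndex

end Summit.BirchSwinnertonDyer.BirchSwinnertonDyer.Theorems.GenusExact.PlusDescent

end
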